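import Literature.Analysis.FluidPDE.SwirlMaximumPrinciple
import Literature.Analysis.FluidPDE.KNSSLemma21Proof
import Literature.Analysis.FluidPDE.KNSSSwirlTransport
import Literature.Analysis.FluidPDE.HouLiSpaceTime
import Literature.Analysis.FluidPDE.TaoEnstrophyLocalisation
import HarnessLib

/-!
# The strong maximum principle for the swirl of a bounded axisymmetric classical flow
# (support item `SwirlSupStrictDecrease`, route `SwirlThreshold`, stmt-NavierStokesRegularity-2004)

Helper file for the proof of `SwirlSupStrictDecrease`.  Let `(v, q)` be a classical solution of
the unforced Navier–Stokes system with unit viscosity on `[0, T] × ℝ³`, `T > 0`, with bounded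
(`|v| ≤ V`) axisymmetric velocity, and suppose `|Γ| ≤ M` on the slab for the swirl
`Γ = x₀v₁ − x₁v₀`, `M > 0`.  Then `|Γ(T, x)| < M` at EVERY point `x` of the final slice
(`abs_swirl_lt_of_classical`): the bound `M` of a weak maximum principle is never attained at a
positive time.

Proof (Koch–Nadirashvili–Seregin–Šverák 2009, Lemma 2.1, in the tree's proved form
`KNSS2009_lemma21_holds`, applied to the swirl equation (1.8) off the axis,
`swirl_transport_holds`).  Suppose `σΓ(T, x₀) = M`, `σ = ±1`; `x₀` is off the axis
(`Γ = 0` there), `r₀ = r(x₀) > 0`.  Put `η = min(r₀/2, M/(4(V+1)))`, let `x₁` be the point of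
the meridian half-plane of `x₀` at distance `η` from the axis and height `z₀`, and `Ω` the open
ball of radius `r₀/2` centred at the midpoint of `x₀x₁`; `Ω` stays at distance `> η/2` from the
axis, so the drift `v + (2/r)e_r` of the swirl equation is bounded by `V + 4/η` on `Ω`, and
`σΓ` lies in the solution class of Lemma 2.1 on `(0, T] × Ω` (smooth slices, time-integrated
equation by the fundamental theorem of calculus).  Lemma 2.1 (with `ε = 1/2`, `τ = T/2`,
`K = {x₀}`) gives `σΓ ≥ M/2` on `(T/2, T) × B(x₁, η/4)`, whereas
`|Γ(t, x₁)| ≤ r(x₁)|v| ≤ ηV ≤ M/4` — a contradiction.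
-/

noncomputable section

-- the summit and its single problem share the name (D-0017 nested layout)
set_option linter.dupNamespace false

open Set Function Filter Topology MeasureTheory InnerProductSpace Metric WithLp
open scoped RealInnerProductSpace Laplacian ContDiff NNReal

namespace Summit.NavierStokesRegularity.NavierStokesRegularity.Theorems.SwirlSupStrictDecrease

open Literature.Analysis.FluidPDE

/-! ### Elementary geometry about the axis -/

/-- `|Γ(x)| = |x₀u₁ − x₁u₀| ≤ r(x) |u(x)|` (Cauchy–Schwarz in the horizontal plane). [folklore] -/
theorem abs_swirl_le_cylRadius_mul_norm (u : (EuclideanSpace ℝ (Fin 3)) → (EuclideanSpace ℝ (Fin 3)))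
    (x : EuclideanSpace ℝ (Fin 3)) : |swirl u x| ≤ cylRadius x * ‖u x‖ := by
  have hn : ‖u x‖ ^ 2 = (u x 0) ^ 2 + (u x 1) ^ 2 + (u x 2) ^ 2 := by
    rw [EuclideanSpace.norm_sq_eq, Fin.sum_univ_three]
    simp only [Real.norm_eq_abs, sq_abs]
  refine abs_le_of_sq_le_sq ?_ (mul_nonneg (cylRadius_nonneg x) (norm_nonneg _))
  rw [mul_pow, cylRadius_sq, hn]
  have : swirl u x = x 0 * u x 1 - x 1 * u x 0 := rfl
  rw [this]
  nlinarith [sq_nonneg (x 0 * u x 0 + x 1 * u x 1), sq_nonneg (x 0), sq_nonneg (x 1),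
    sq_nonneg (u x 2), mul_nonneg (add_nonneg (sq_nonneg (x 0)) (sq_nonneg (x 1))) (sq_nonneg (u x 2))]

/-- The cylindrical radius is `1`-Lipschitz: `r(x) − r(y) ≤ |x − y|`. [folklore] -/
theorem cylRadius_sub_le_norm (x y : EuclideanSpace ℝ (Fin 3)) : cylRadius x - cylRadius y ≤ ‖x - y‖ := by
  -- `r(x) ≤ r(y) + r(x - y)` (Minkowski in the plane) and `r(x - y) ≤ |x - y|`
  have hxy : cylRadius x ≤ cylRadius y + cylRadius (x - y) := by
    have h1 : 0 ≤ cylRadius y + cylRadius (x - y) :=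
      add_nonneg (cylRadius_nonneg _) (cylRadius_nonneg _)
    refine Real.sqrt_le_iff.2 ⟨h1, ?_⟩
    have ey : cylRadius y ^ 2 = y 0 ^ 2 + y 1 ^ 2 := cylRadius_sq y
    have ed : cylRadius (x - y) ^ 2 = (x 0 - y 0) ^ 2 + (x 1 - y 1) ^ 2 := by
      rw [cylRadius_sq]; simp
    -- Cauchy–Schwarz: `y₀(x₀-y₀) + y₁(x₁-y₁) ≤ r(y) r(x-y)`
    have hcs : y 0 * (x 0 - y 0) + y 1 * (x 1 - y 1) ≤ cylRadius y * cylRadius (x - y) := by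
      have hp : 0 ≤ cylRadius y * cylRadius (x - y) :=
        mul_nonneg (cylRadius_nonneg _) (cylRadius_nonneg _)
      refine (le_abs_self _).trans (abs_le_of_sq_le_sq ?_ hp)
      rw [mul_pow, ey, ed]
      nlinarith [sq_nonneg (y 0 * (x 1 - y 1) - y 1 * (x 0 - y 0))]
    nlinarith [hcs, ey, ed]
  have hle : cylRadius (x - y) ≤ ‖x - y‖ := by
    refine Real.sqrt_le_iff.2 ⟨norm_nonneg _, ?_⟩
    rw [EuclideanSpace.norm_sq_eq, Fin.sum_univ_three]
    simp only [Real.norm_eq_abs, sq_abs]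
    nlinarith [sq_nonneg ((x - y) 2)]
  linarith

/-- The cylindrical radius of a horizontally rescaled point `(μa, μb, z)`. [folklore] -/
theorem cylRadius_hScale (a b z μ : ℝ) :
    cylRadius (toLp 2 ![μ * a, μ * b, z] : EuclideanSpace ℝ (Fin 3)) = |μ| * Real.sqrt (a ^ 2 + b ^ 2) := by
  unfold cylRadius
  have : (toLp 2 ![μ * a, μ * b, z] : EuclideanSpace ℝ (Fin 3)) 0 ^ 2 +
      (toLp 2 ![μ * a, μ * b, z] : EuclideanSpace ℝ (Fin 3)) 1 ^ 2 = μ ^ 2 * (a ^ 2 + b ^ 2) := by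
    simp; ring
  rw [this, Real.sqrt_mul (sq_nonneg μ), Real.sqrt_sq_eq_abs]

/-- The distance between two horizontally rescaled points `(μa, μb, z)`, `(μ'a, μ'b, z)`. [folklore] -/
theorem dist_hScale (a b z μ μ' : ℝ) :
    dist (toLp 2 ![μ * a, μ * b, z] : EuclideanSpace ℝ (Fin 3)) (toLp 2 ![μ' * a, μ' * b, z]) =
      |μ - μ'| * Real.sqrt (a ^ 2 + b ^ 2) := by
  rw [EuclideanSpace.dist_eq, Fin.sum_univ_three]
  simp only [Matrix.cons_val_zero, Matrix.cons_val_one, Matrix.cons_val_two,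
    Matrix.head_cons, Matrix.tail_cons, Real.dist_eq]
  have e : |μ * a - μ' * a| ^ 2 + |μ * b - μ' * b| ^ 2 + |z - z| ^ 2 = (μ - μ') ^ 2 * (a ^ 2 + b ^ 2) := by
    simp only [sq_abs, sub_self, abs_zero]; ring
  rw [e, Real.sqrt_mul (sq_nonneg _), Real.sqrt_sq_eq_abs]

/-! ### The swirl in the solution class of Lemma 2.1 -/

section Lemma21Class

variable {T V : ℝ} {v : ℝ → (EuclideanSpace ℝ (Fin 3)) → (EuclideanSpace ℝ (Fin 3))}
  {q : ℝ → (EuclideanSpace ℝ (Fin 3)) → ℝ}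

/-- **Regularity clauses of Lemma 2.1 for `σΓ`**: `C²` slices, `∇(σΓ)` and `Δ(σΓ)` jointly
continuous on `(0, T] × Ω` (the swirl family of a jointly smooth velocity is jointly smooth,
`IsSmoothSpaceTimeOn.swirl_family`, `.fderiv_slice`, `.laplacian`). [folklore] -/
theorem swirl_lemma21_regularity (hT : 0 < T) (hcl : IsClassicalNSSolutionOn (Icc 0 T) 1 0 v q)
    (σ : ℝ) (Ω : Set (EuclideanSpace ℝ (Fin 3))) :
    (∀ t ∈ Ioc 0 T, ContDiffOn ℝ 2 (fun y => σ * swirl (v t) y) Ω) ∧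
    ContinuousOn (fun p : ℝ × (EuclideanSpace ℝ (Fin 3)) => fderiv ℝ (fun y => σ * swirl (v p.1) y) p.2)
      (Ioc 0 T ×ˢ Ω) ∧
    ContinuousOn (fun p : ℝ × (EuclideanSpace ℝ (Fin 3)) => (Δ (fun y => (σ * swirl (v p.1) y : ℝ))) p.2)
      (Ioc 0 T ×ˢ Ω) := by
  have hU : UniqueDiffOn ℝ (Icc 0 T) := uniqueDiffOn_Icc hT
  have hsw : IsSmoothSpaceTimeOn (Icc 0 T) (fun t => swirl (v t)) := hcl.smooth_velocity.swirl_family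
  have hvC2 : ∀ t ∈ Icc 0 T, ContDiff ℝ 2 (v t) := fun t ht =>
    (hcl.contDiff_velocity ht).of_le (by norm_cast)
  have hsub : Ioc 0 T ×ˢ Ω ⊆ Icc 0 T ×ˢ (univ : Set (EuclideanSpace ℝ (Fin 3))) :=
    prod_mono Ioc_subset_Icc_self (subset_univ _)
  refine ⟨fun t ht => ?_, ?_, ?_⟩
  · exact (contDiff_const.mul (contDiff_swirl (hvC2 t (Ioc_subset_Icc_self ht)))).contDiffOn
  · have hF := (hsw.fderiv_slice hU).continuousOn.mono hsub
    refine ((continuousOn_const (c := σ)).smul hF).congr fun p hp => ?_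
    have hpt : p.1 ∈ Icc 0 T := Ioc_subset_Icc_self hp.1
    have hΓd : DifferentiableAt ℝ (swirl (v p.1)) p.2 :=
      differentiableAt_swirl (((hvC2 p.1 hpt).of_le one_le_two).differentiable one_ne_zero p.2)
    exact (hΓd.hasFDerivAt.const_mul σ).fderiv
  · have hL := (hsw.laplacian hU).continuousOn.mono hsub
    refine ((continuousOn_const (c := σ)).smul hL).congr fun p hp => ?_
    have hpt : p.1 ∈ Icc 0 T := Ioc_subset_Icc_self hp.1
    have e : (fun y => (σ * swirl (v p.1) y : ℝ)) = σ • swirl (v p.1) := by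
      funext y; simp [smul_eq_mul]
    show (Δ (fun y => (σ * swirl (v p.1) y : ℝ))) p.2 = σ • (Δ (swirl (v p.1))) p.2
    rw [e, laplacian_smul σ ((contDiff_swirl (hvC2 p.1 hpt)).contDiffAt)]

/-- **The time-integrated swirl equation off the axis** (KNSS 2009, (1.8), unit viscosity, in the
form of Lemma 2.1): for `r(y) ≠ 0` and `0 < s ≤ t ≤ T`,
`σΓ(t, y) − σΓ(s, y) = ∫ₛᵗ (Δ(σΓ)(y) − ∇(σΓ)(y)·(v + (2/r)e_r)) dr`, the drift being frozen by
the clamp `r ↦ max 0 (min r T)` outside `[0, T]` (immaterial on `[s, t]`). Proof: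
`swirl_transport_holds` pointwise in time and the fundamental theorem of calculus. [folklore] -/
theorem swirl_lemma21_eqn (hT : 0 < T) (hcl : IsClassicalNSSolutionOn (Icc 0 T) 1 0 v q)
    (haxi : ∀ t ∈ Icc 0 T, IsAxisymmetric (v t)) (σ : ℝ) {y : EuclideanSpace ℝ (Fin 3)}
    (hy : cylRadius y ≠ 0) {s t : ℝ} (hs : 0 < s) (hst : s ≤ t) (htT : t ≤ T) :
    σ * swirl (v t) y - σ * swirl (v s) y =
      ∫ r in s..t, ((Δ (fun w => (σ * swirl (v r) w : ℝ))) y -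
        fderiv ℝ (fun w => σ * swirl (v r) w) y
          (v (max 0 (min r T)) y + (2 / cylRadius y) • eR y)) := by
  have hU : UniqueDiffOn ℝ (Icc 0 T) := uniqueDiffOn_Icc hT
  have hsw : IsSmoothSpaceTimeOn (Icc 0 T) (fun t => swirl (v t)) := hcl.smooth_velocity.swirl_family
  have hvC2 : ∀ t ∈ Icc 0 T, ContDiff ℝ 2 (v t) := fun t ht =>
    (hcl.contDiff_velocity ht).of_le (by norm_cast)
  have hΓd : ∀ r ∈ Icc 0 T, DifferentiableAt ℝ (swirl (v r)) y := fun r hr =>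
    differentiableAt_swirl (((hvC2 r hr).of_le one_le_two).differentiable one_ne_zero y)
  have hIcc : Icc s t ⊆ Icc 0 T := Icc_subset_Icc hs.le htT
  have hclamp : ∀ r ∈ Icc 0 T, max 0 (min r T) = r := fun r hr => by
    rw [min_eq_left hr.2, max_eq_right hr.1]
  -- the pressure is axisymmetric, so the swirl equation holds off the axis
  have hp : ∀ t ∈ Icc 0 T, IsAxisymmetricScalar (q t) := fun t ht =>
    hcl.isAxisymmetricScalar_pressure hU haxi (fun _ _ => isAxisymmetric_zero) ht
  -- pointwise identities for the slices
  have hfd : ∀ r ∈ Icc 0 T, fderiv ℝ (fun w => σ * swirl (v r) w) y = σ • fderiv ℝ (swirl (v r)) y :=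
    fun r hr => ((hΓd r hr).hasFDerivAt.const_mul σ).fderiv
  have hlap : ∀ r ∈ Icc 0 T, (Δ (fun w => (σ * swirl (v r) w : ℝ))) y = σ * (Δ (swirl (v r))) y := by
    intro r hr
    have e : (fun w => (σ * swirl (v r) w : ℝ)) = σ • swirl (v r) := by
      funext w; simp [smul_eq_mul]
    rw [e, laplacian_smul σ ((contDiff_swirl (hvC2 r hr)).contDiffAt), smul_eq_mul]
  -- the swirl equation at `(r, y)`, `r ∈ [0, T]`, solved for the time derivative
  have hpde : ∀ r ∈ Icc 0 T, timeDerivWithin (Icc 0 T) (fun s => swirl (v s)) r y =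
      (Δ (swirl (v r))) y - fderiv ℝ (swirl (v r)) y (v r y + (2 / cylRadius y) • eR y) := by
    intro r hr
    have h := swirl_transport_holds hcl haxi hp hr hy
    have hf0 : swirl ((0 : ℝ → (EuclideanSpace ℝ (Fin 3)) → (EuclideanSpace ℝ (Fin 3))) r) y = 0 := by
      simp [swirl]
    rw [hf0, add_zero, convect_apply, partialDeriv_apply, one_mul] at h
    rw [map_add, map_smul, smul_eq_mul]
    linarith
  -- the integrand is continuous on `[s, t]`
  set g : ℝ → ℝ := fun r => (Δ (fun w => (σ * swirl (v r) w : ℝ))) y -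
    fderiv ℝ (fun w => σ * swirl (v r) w) y (v (max 0 (min r T)) y + (2 / cylRadius y) • eR y) with hg
  have hpair : Continuous fun r : ℝ => ((r, y) : ℝ × (EuclideanSpace ℝ (Fin 3))) := by fun_prop
  have hmaps : MapsTo (fun r : ℝ => ((r, y) : ℝ × (EuclideanSpace ℝ (Fin 3)))) (Icc s t)
      (Icc 0 T ×ˢ (univ : Set (EuclideanSpace ℝ (Fin 3)))) := fun r hr => ⟨hIcc hr, mem_univ _⟩
  have hgc : ContinuousOn g (Icc s t) := by
    have h1' := (hsw.laplacian hU).continuousOn.comp hpair.continuousOn hmaps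
    have h1 : ContinuousOn (fun r => (Δ (swirl (v r))) y) (Icc s t) := h1'.congr fun r _ => rfl
    have h2' := (hsw.fderiv_slice hU).continuousOn.comp hpair.continuousOn hmaps
    have h2 : ContinuousOn (fun r => fderiv ℝ (swirl (v r)) y) (Icc s t) := h2'.congr fun r _ => rfl
    have h3' := hcl.smooth_velocity.continuousOn.comp hpair.continuousOn hmaps
    have h3 : ContinuousOn (fun r => v r y) (Icc s t) := h3'.congr fun r _ => rfl
    have h4 : ContinuousOn (fun r => v r y + (2 / cylRadius y) • eR y) (Icc s t) :=
      h3.add continuousOn_const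
    have h5 : ContinuousOn (fun r => σ * (Δ (swirl (v r))) y -
        σ * fderiv ℝ (swirl (v r)) y (v r y + (2 / cylRadius y) • eR y)) (Icc s t) :=
      ((continuousOn_const (c := σ)).mul h1).sub ((continuousOn_const (c := σ)).mul (h2.clm_apply h4))
    refine h5.congr fun r hr => ?_
    have hr' : r ∈ Icc 0 T := hIcc hr
    simp only [hg, hlap r hr', hfd r hr', hclamp r hr', smul_apply, smul_eq_mul]
  -- the primitive and its derivative on `(s, t)`
  have hGc : ContinuousOn (fun r => σ * swirl (v r) y) (Icc s t) := by
    have h1' := hsw.continuousOn.comp hpair.continuousOn hmaps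
    have h1 : ContinuousOn (fun r => swirl (v r) y) (Icc s t) := h1'.congr fun r _ => rfl
    exact (continuousOn_const (c := σ)).mul h1
  have hGd : ∀ r ∈ Ioo s t, HasDerivAt (fun r => σ * swirl (v r) y) (g r) r := by
    intro r hr
    have hr' : r ∈ Icc 0 T := ⟨(hs.trans hr.1).le, hr.2.le.trans htT⟩
    have hnhds : Icc 0 T ∈ 𝓝 r := Icc_mem_nhds (hs.trans hr.1) (lt_of_lt_of_le hr.2 htT)
    have h1 : HasDerivAt (fun r => swirl (v r) y)
        (timeDerivWithin (Icc 0 T) (fun s => swirl (v s)) r y) r :=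
      (hsw.hasDerivWithinAt_timeDerivWithin hU hr' y).hasDerivAt hnhds
    refine (h1.const_mul σ).congr_deriv ?_
    rw [hpde r hr', hg]
    simp only [hlap r hr', hfd r hr', hclamp r hr', smul_apply, smul_eq_mul]
    ring
  have hint : IntervalIntegrable g volume s t := hgc.intervalIntegrable_of_Icc hst
  have := intervalIntegral.integral_eq_sub_of_hasDerivAt_of_le hst hGc hGd hint
  rw [this]

/-- **The merged drift `v + (2/r) e_r` of the swirl equation**, clamped in time to `[0, T]`: it is
jointly measurable, and bounded by `V + 4/η` on `(0, T] × Ω` whenever `|v| ≤ V` on the slab and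
`Ω ⊆ {r > η/2}`. [folklore] -/
theorem swirl_lemma21_drift (hT : 0 < T) (hcl : IsClassicalNSSolutionOn (Icc 0 T) 1 0 v q)
    (hV : ∀ t ∈ Icc 0 T, ∀ x, ‖v t x‖ ≤ V) {η : ℝ} (hη : 0 < η)
    {Ω : Set (EuclideanSpace ℝ (Fin 3))} (hΩ : ∀ y ∈ Ω, η / 2 < cylRadius y) :
    Measurable (uncurry fun (r : ℝ) (y : EuclideanSpace ℝ (Fin 3)) =>
      v (max 0 (min r T)) y + (2 / cylRadius y) • eR y) ∧
    ∀ r ∈ Ioc 0 T, ∀ y ∈ Ω, ‖v (max 0 (min r T)) y + (2 / cylRadius y) • eR y‖ ≤ V + 4 / η := by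
  have hclamp_mem : ∀ r : ℝ, max 0 (min r T) ∈ Icc 0 T := fun r =>
    ⟨le_max_left _ _, max_le hT.le (min_le_right _ _)⟩
  refine ⟨?_, fun r hr y hyΩ => ?_⟩
  · -- measurability: the clamped velocity is jointly continuous
    have hc : Continuous fun p : ℝ × (EuclideanSpace ℝ (Fin 3)) => v (max 0 (min p.1 T)) p.2 := by
      have hg : Continuous fun p : ℝ × (EuclideanSpace ℝ (Fin 3)) =>
          ((max 0 (min p.1 T), p.2) : ℝ × (EuclideanSpace ℝ (Fin 3))) := by fun_prop
      have h' := hcl.smooth_velocity.continuousOn.comp_continuous hg fun p => ⟨hclamp_mem p.1, mem_univ _⟩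
      exact h'.congr fun p => rfl
    have h1 : Measurable fun p : ℝ × (EuclideanSpace ℝ (Fin 3)) => (2 / cylRadius p.2) • eR p.2 :=
      ((measurable_const.div continuous_cylRadius.measurable).comp measurable_snd).smul
        (measurable_eR.comp measurable_snd)
    exact hc.measurable.add h1
  · have hr0 : 0 < cylRadius y := lt_trans (by positivity) (hΩ y hyΩ)
    have h1 : ‖v (max 0 (min r T)) y‖ ≤ V := hV _ (hclamp_mem r) y
    have h2 : ‖(2 / cylRadius y) • eR y‖ ≤ 4 / η := by
      rw [norm_smul, Real.norm_eq_abs, abs_of_nonneg (by positivity)]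
      have h3 : 2 / cylRadius y ≤ 4 / η := by
        rw [div_le_div_iff₀ hr0 hη]
        linarith [hΩ y hyΩ]
      calc 2 / cylRadius y * ‖eR y‖ ≤ 4 / η * 1 :=
            mul_le_mul h3 (norm_eR_le_one y) (norm_nonneg _) (by positivity)
        _ = 4 / η := mul_one _
    exact (norm_add_le _ _).trans (add_le_add h1 h2)

end Lemma21Class

/-! ### The strong maximum principle -/

/-- **Strong maximum principle for the swirl.** Let `(v, q)` be a classical solution of the
unforced Navier–Stokes system with unit viscosity on `[0, T] × ℝ³`, `T > 0`, with axisymmetric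
velocity bounded by `V`, and let `|Γ| ≤ M` on `[0, T] × ℝ³`, `M > 0`. Then `|Γ(T, x)| < M` for
every `x` (KNSS 2009, Lemma 2.1, `KNSS2009_lemma21_holds`, on a ball away from the axis
joining a would-be extremal point to a point near the axis, where `|Γ| ≤ r|v|` is small; see the
module docstring). -/
theorem abs_swirl_lt_of_classical {T V M : ℝ} {v : ℝ → (EuclideanSpace ℝ (Fin 3)) → (EuclideanSpace ℝ (Fin 3))}
    {q : ℝ → (EuclideanSpace ℝ (Fin 3)) → ℝ} (hT : 0 < T)
    (hcl : IsClassicalNSSolutionOn (Icc 0 T) 1 0 v q) (haxi : ∀ t ∈ Icc 0 T, IsAxisymmetric (v t))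
    (hV : ∀ t ∈ Icc 0 T, ∀ x, ‖v t x‖ ≤ V) (hMpos : 0 < M)
    (hM : ∀ t ∈ Icc 0 T, ∀ x, |swirl (v t) x| ≤ M) : ∀ x, |swirl (v T) x| < M := by
  intro x₀
  by_contra hnot
  have hTI : T ∈ Icc 0 T := ⟨hT.le, le_rfl⟩
  have hEq : |swirl (v T) x₀| = M := le_antisymm (hM T hTI x₀) (not_lt.1 hnot)
  have hV0 : 0 ≤ V := (norm_nonneg _).trans (hV 0 ⟨le_rfl, hT.le⟩ 0)
  -- `x₀` is off the axis
  set r₀ : ℝ := cylRadius x₀ with hr₀def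
  have hr₀ : r₀ ≠ 0 := by
    intro h0
    have := swirl_eq_zero_of_cylRadius_eq_zero (v T) h0
    rw [this, abs_zero] at hEq
    exact hMpos.ne hEq
  have hr₀pos : 0 < r₀ := lt_of_le_of_ne (cylRadius_nonneg x₀) (Ne.symm hr₀)
  -- the sign
  obtain ⟨σ, hσ, hσM⟩ : ∃ σ : ℝ, (σ = 1 ∨ σ = -1) ∧ σ * swirl (v T) x₀ = M := by
    rcases le_or_gt 0 (swirl (v T) x₀) with h | h
    · exact ⟨1, Or.inl rfl, by rw [one_mul, ← hEq, abs_of_nonneg h]⟩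
    · exact ⟨-1, Or.inr rfl, by rw [neg_one_mul, ← hEq, abs_of_neg h]⟩
  have hσabs : ∀ a : ℝ, |σ * a| = |a| := fun a => by
    rcases hσ with h | h <;> simp [h]
  -- the scale `η`
  set η : ℝ := min (r₀ / 2) (M / (4 * (V + 1))) with hηdef
  have hη0 : 0 < η := lt_min (by positivity) (by positivity)
  have hηr : η ≤ r₀ / 2 := min_le_left _ _
  have hηM : η * (V + 1) ≤ M / 4 := by
    have h1 : η ≤ M / (4 * (V + 1)) := min_le_right _ _
    rw [le_div_iff₀ (by positivity)] at h1
    linarith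
  -- the points `x₁` (near the axis) and `c` (centre), in the meridian half-plane of `x₀`
  set a : ℝ := x₀ 0 with hadef
  set b : ℝ := x₀ 1 with hbdef
  set z : ℝ := x₀ 2 with hzdef
  have hab : Real.sqrt (a ^ 2 + b ^ 2) = r₀ := by rw [hr₀def, cylRadius]
  have hx₀P : x₀ = (toLp 2 ![1 * a, 1 * b, z] : EuclideanSpace ℝ (Fin 3)) := by
    ext i; fin_cases i <;> simp [hadef, hbdef, hzdef]
  set μ₁ : ℝ := η / r₀ with hμ₁
  set μc : ℝ := (r₀ + η) / (2 * r₀) with hμc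
  set x₁ : EuclideanSpace ℝ (Fin 3) := toLp 2 ![μ₁ * a, μ₁ * b, z] with hx₁
  set c : EuclideanSpace ℝ (Fin 3) := toLp 2 ![μc * a, μc * b, z] with hc
  have hμ₁0 : 0 < μ₁ := by positivity
  have hμc0 : 0 < μc := by positivity
  have hr₁ : cylRadius x₁ = η := by
    rw [hx₁, cylRadius_hScale, hab, abs_of_pos hμ₁0, hμ₁, div_mul_cancel₀ _ hr₀]
  have hrc : cylRadius c = (r₀ + η) / 2 := by
    rw [hc, cylRadius_hScale, hab, abs_of_pos hμc0, hμc]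
    field_simp
  have hηr₀ : η < r₀ := by linarith
  have hd₀ : dist x₀ c = (r₀ - η) / 2 := by
    rw [hx₀P, hc, dist_hScale, hab, hμc]
    have e : (1 - (r₀ + η) / (2 * r₀)) = ((r₀ - η) / 2) / r₀ := by field_simp; ring
    rw [e, abs_of_nonneg (by positivity), div_mul_cancel₀ _ hr₀]
  have hd₁ : dist x₁ c = (r₀ - η) / 2 := by
    rw [hx₁, hc, dist_hScale, hab, hμc, hμ₁]
    have e : (η / r₀ - (r₀ + η) / (2 * r₀)) = -(((r₀ - η) / 2) / r₀) := by field_simp; ring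
    rw [e, abs_neg, abs_of_nonneg (by positivity), div_mul_cancel₀ _ hr₀]
  -- the region `Ω = B(c, r₀/2)` and its distance to the axis
  set Ω : Set (EuclideanSpace ℝ (Fin 3)) := ball c (r₀ / 2) with hΩdef
  have hx₀Ω : x₀ ∈ Ω := by
    rw [hΩdef, mem_ball, hd₀]; linarith
  have hx₁Ω : x₁ ∈ Ω := by
    rw [hΩdef, mem_ball, hd₁]; linarith
  have hΩaxis : ∀ y ∈ Ω, η / 2 < cylRadius y := by
    intro y hy
    rw [hΩdef, mem_ball, dist_eq_norm] at hy
    have h1 := cylRadius_sub_le_norm c y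
    rw [hrc] at h1
    have h2 : ‖c - y‖ = ‖y - c‖ := norm_sub_rev _ _
    linarith
  set Ω' : Set (EuclideanSpace ℝ (Fin 3)) := ball x₁ (η / 4) with hΩ'def
  have hΩ'Ω : closure Ω' ⊆ Ω := by
    refine closure_ball_subset_closedBall.trans fun y hy => ?_
    rw [mem_closedBall] at hy
    rw [hΩdef, mem_ball]
    have := dist_triangle y x₁ c
    rw [hd₁] at this
    linarith
  -- Lemma 2.1
  obtain ⟨δ, hδ, hL⟩ := KNSS2009_lemma21_holds (EuclideanSpace ℝ (Fin 3)) (Ω := Ω) (Ω' := Ω')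
    (K := {x₀}) (T := T) (τ := T / 2) (A := V + 4 / η) (ε := 1 / 2) isOpen_ball isBounded_ball
    (isConnected_ball (by positivity)) hΩ'Ω isCompact_singleton (singleton_subset_iff.2 hx₀Ω)
    (by positivity) (by norm_num)
  obtain ⟨hmeas, hdrift⟩ := swirl_lemma21_drift hT hcl hV hη0 hΩaxis
  obtain ⟨hC2, hDc, hLc⟩ := swirl_lemma21_regularity hT hcl σ Ω
  have heqn : ∀ y ∈ Ω, ∀ s t : ℝ, 0 < s → s ≤ t → t ≤ T →
      σ * swirl (v t) y - σ * swirl (v s) y =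
        ∫ r in s..t, ((Δ (fun w => (σ * swirl (v r) w : ℝ))) y -
          fderiv ℝ (fun w => σ * swirl (v r) w) y (v (max 0 (min r T)) y + (2 / cylRadius y) • eR y)) :=
    fun y hy s t hs hst htT =>
      swirl_lemma21_eqn hT hcl haxi σ (by linarith [hΩaxis y hy, hη0.le] : cylRadius y ≠ 0) hs hst htT
  have hbound : ∀ t ∈ Ioc 0 T, ∀ y ∈ Ω, |σ * swirl (v t) y| ≤ M := fun t ht y _ => by
    rw [hσabs]; exact hM t (Ioc_subset_Icc_self ht) y
  have hK : ∃ x ∈ ({x₀} : Set (EuclideanSpace ℝ (Fin 3))), M * (1 - δ) ≤ σ * swirl (v T) x :=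
    ⟨x₀, mem_singleton _, by rw [hσM]; nlinarith⟩
  have hconcl := hL hmeas hdrift hC2 hDc hLc heqn hMpos hbound hK (3 * T / 4)
    ⟨by linarith, by linarith⟩ x₁ (mem_ball_self (by positivity))
  -- contradiction at `(3T/4, x₁)`: `|Γ| ≤ r(x₁)|v| = η|v| ≤ η V ≤ M/4 < M/2`
  have h34 : 3 * T / 4 ∈ Icc 0 T := ⟨by positivity, by linarith⟩
  have hsmall : σ * swirl (v (3 * T / 4)) x₁ ≤ M / 4 := by
    refine (le_abs_self _).trans ?_
    rw [hσabs]
    refine (abs_swirl_le_cylRadius_mul_norm _ _).trans ?_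
    rw [hr₁]
    calc η * ‖v (3 * T / 4) x₁‖ ≤ η * V := mul_le_mul_of_nonneg_left (hV _ h34 x₁) hη0.le
      _ ≤ η * (V + 1) := by nlinarith
      _ ≤ M / 4 := hηM
  linarith

end Summit.NavierStokesRegularity.NavierStokesRegularity.Theorems.SwirlSupStrictDecrease

end
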